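import Summits.BirchSwinnertonDyer.BirchSwinnertonDyer.Theses.SchneiderFreeAdditiveX3
import Literature.NumberTheory.EllipticCurves.RationalIsogenyPrimeDegreeJInvariants
import Literature.NumberTheory.EllipticCurves.OpenImage
import HarnessLib

/-!
# Route `SchneiderFreeAdditiveX3` (K1 door), crux r2 `PotMultBranchIMC` (item 19176): the potentially MULTIPLICATIVE reducible row (M) is
# EMPTY at `p ∈ {11, 17, 19, 37, 43, 67, 163}` — Mazur's eleven moduli are all `p`-integral — so the crux has content only at `p ∈ {3, 5, 7, 13}`

Cell `bsd-schneider-ideate`, seat `bsd-schneider-door-c5` (prover, generation 35; assembly layer; `--supports` 19176 — the (M) twin of this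
seat's generation-35 `KYBranchRowPrimes` for r3/19177).  PARTITION: board row B6 ∩ X3 ∩ sst-twist, `r = 1`, the (M) half (4 541 of 7 101 census
pairs, all at `p ∈ {3, 5, 7, 13}`) of `Rank1Residual.partition` — ASSEMBLY; types-the-object-of nothing new; closes none of B6's cells (BSD NOT
advanced).  bears_on: K1-door (items 18971/18972 → 19176 r2 `PotMultBranchIMC`, door-c2's line; this file only records where r2 is vacuous).

WHY.  Crux r2 quantifies over every odd prime `p`, under `ClassX3 W p` (`Red W p`: a rational `p`-isogeny) and `SubM W p` (`= PotMult W p`: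
`v_p(j(W)) < 0`).  By Mazur's theorem (`mazur_isogeny_irreducible`) `p` is one of the twelve isogeny primes; by Mazur's `j`-table
(`mazur_j_mem_of_not_hasIrreducibleModPGaloisRep_of_eleven_le`) at `p ∈ {11, 17, 19, 37, 43, 67, 163}` the `j`-invariant is one of eleven values —
`−2¹⁵, −11², −11·131³` (`11`), `−17²·101³/2, −17·373³/2¹⁷` (`17`), `−2¹⁵3³` (`19`), `−7·11³, −7·137³·2083³` (`37`), `−2¹⁸3³5³` (`43`),
`−2¹⁵3³5³11³` (`67`), `−2¹⁸3³5³23³29³` (`163`) — EVERY ONE OF WHICH IS `p`-INTEGRAL (`v_p(j) ≥ 0`; the only denominators are powers of `2`).  So no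
curve of the (M) row exists at these seven primes, and crux r2 has content only at `p ∈ {3, 5, 7, 13}` (the census primes of the (M) half).
* §1 `padicValRat_nonneg_of_eq_int_div` — `v_p(a/b) ≥ 0` for `p ∤ b` (bookkeeping).
* §2 **`not_potMult_of_red_of_mem_seven`** — `Red W p`, `p ∈ {11, 17, 19, 37, 43, 67, 163}` ⟹ `¬ PotMult W p` (Mazur's `j`-table displayed);
  `false_of_classX3_of_subM_of_mem`.
* §3 **`mem_rowPrimesM_of_classX3_of_subM`** — on the (M) row `p ∈ {2, 3, 5, 7, 13}` (Mazur Thm. 1 + `j`-table displayed).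
* §4 **`potMultBranchIMC_of_rowPrimes`** — crux r2 BY NAME is the conjunction of its OWN instances at `p ∈ {3, 5, 7, 13}` (vacuous elsewhere).

HONEST FRAMING: §1 is unconditional; §2–§4 are CONDITIONAL on Mazur's two displayed published facts; no definition, no new named fact, no
`sorry`; crux 19176 stays OPEN (door-c2's line; nothing of its mathematics is touched); BSD is proved for no curve; «closes rung: none».
References: Mazur, Invent. Math. 44 (1978) Thm. 1, Thm. 7.1, table p. 129 [Mazur1978]; Lozano-Robledo, Math. Ann. 357 (2013) Table 4
[LozanoRobledo2013MathAnn]; Silverman AEC VII.5.1(b) (`v_p(j) < 0` ⟺ potentially multiplicative) [SilvermanAEC2009]; this seat p739034 (F24d).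
-/

set_option autoImplicit false
-- `Summit.<P>.<Sub>` repeats `BirchSwinnertonDyer` by the tree's layout convention (D-0017)
set_option linter.dupNamespace false

noncomputable section

open scoped Classical

open WeierstrassCurve Literature.NumberTheory.EllipticCurves Literature.NumberTheory.EllipticCurves.Rank1Residual
  Summit.BirchSwinnertonDyer.Rank1Residual Summit.BirchSwinnertonDyer.BirchSwinnertonDyer.Theorems.SchneiderFree

namespace Summit.BirchSwinnertonDyer.BirchSwinnertonDyer.Theorems.SchneiderFreeAdditiveX3.KYBranchRowPrimesPotMult

/-! ### §1 `v_p(a/b) ≥ 0` when `p ∤ b` -/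

/-- `v_p(a/b) ≥ 0` for integers `a`, `b` with `p ∤ b` (`b ≠ 0`; `a = 0` gives the junk value `0`). [folklore] -/
theorem padicValRat_nonneg_of_eq_int_div {p : ℕ} [Fact p.Prime] {q : ℚ} {a b : ℤ} (hb : b ≠ 0) (hpb : ¬ (p : ℤ) ∣ b)
    (hq : q = (a : ℚ) / (b : ℚ)) : 0 ≤ padicValRat p q := by
  subst hq
  by_cases ha : a = 0
  · simp [ha]
  · rw [padicValRat.div (by exact_mod_cast ha) (by exact_mod_cast hb), padicValRat.of_int, padicValRat.of_int,
      padicValInt.eq_zero_of_not_dvd hpb]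
    simp

/-! ### §2 Mazur's eleven moduli are `p`-integral: no (M) row at `p ∈ {11, 17, 19, 37, 43, 67, 163}` -/

/-- **A rational `p`-isogeny at `p ∈ {11, 17, 19, 37, 43, 67, 163}` forces `v_p(j) ≥ 0`** — every modulus of Mazur's table is `p`-integral (the
only denominators, at `17`, are powers of `2`) — so `W` is NOT potentially multiplicative at `p` (`PotMult W p := v_p(j) < 0`).  CONDITIONAL on the
displayed published fact. [cite: Mazur1978, Thm. 1 and table p. 129] [cite: LozanoRobledo2013MathAnn, Table 4] [cite: SilvermanAEC2009, VII.5 Prop. 5.1(b)] -/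
theorem not_potMult_of_red_of_mem_seven (hJ : mazur_j_mem_of_not_hasIrreducibleModPGaloisRep_of_eleven_le) {p : ℕ} [Fact p.Prime]
    (hp : p = 11 ∨ p = 17 ∨ p = 19 ∨ p = 37 ∨ p = 43 ∨ p = 67 ∨ p = 163) (W : WeierstrassCurve ℚ) [W.IsElliptic] [W.IsGloballyMinimal]
    (hred : ¬ W.HasIrreducibleModPGaloisRep p) : ¬ Additive.PotMult W p := by
  unfold Additive.PotMult
  rw [not_lt]
  obtain ⟨rfl, hj⟩ | ⟨rfl, hj⟩ | ⟨rfl, hj⟩ | ⟨rfl, hj⟩ | ⟨rfl, hj⟩ | ⟨rfl, hj⟩ | ⟨rfl, hj⟩ := hJ W p (by omega) (by omega) hred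
  · rcases hj with hj | hj | hj
    · exact padicValRat_nonneg_of_eq_int_div (a := -32768) (b := 1) one_ne_zero (by omega) (by rw [hj]; norm_num)
    · exact padicValRat_nonneg_of_eq_int_div (a := -121) (b := 1) one_ne_zero (by omega) (by rw [hj]; norm_num)
    · exact padicValRat_nonneg_of_eq_int_div (a := -24729001) (b := 1) one_ne_zero (by omega) (by rw [hj]; norm_num)
  · rcases hj with hj | hj
    · exact padicValRat_nonneg_of_eq_int_div (a := -297756989) (b := 2) two_ne_zero (by omega) (by rw [hj]; norm_num)
    · exact padicValRat_nonneg_of_eq_int_div (a := -882216989) (b := 131072) (by norm_num) (by omega) (by rw [hj]; norm_num)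
  · exact padicValRat_nonneg_of_eq_int_div (a := -884736) (b := 1) one_ne_zero (by omega) (by rw [hj]; norm_num)
  · rcases hj with hj | hj
    · exact padicValRat_nonneg_of_eq_int_div (a := -9317) (b := 1) one_ne_zero (by omega) (by rw [hj]; norm_num)
    · exact padicValRat_nonneg_of_eq_int_div (a := -162677523113838677) (b := 1) one_ne_zero (by omega) (by rw [hj]; norm_num)
  · exact padicValRat_nonneg_of_eq_int_div (a := -884736000) (b := 1) one_ne_zero (by omega) (by rw [hj]; norm_num)
  · exact padicValRat_nonneg_of_eq_int_div (a := -147197952000) (b := 1) one_ne_zero (by omega) (by rw [hj]; norm_num)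
  · exact padicValRat_nonneg_of_eq_int_div (a := -262537412640768000) (b := 1) one_ne_zero (by omega) (by rw [hj]; norm_num)

/-- **The reducible (M) row `ClassX3 W p ∧ SubM W p` is EMPTY at `p ∈ {11, 17, 19, 37, 43, 67, 163}`.**  CONDITIONAL on Mazur's `j`-table
(displayed). [cite: Mazur1978, Thm. 1 and table p. 129] -/
theorem false_of_classX3_of_subM_of_mem (hJ : mazur_j_mem_of_not_hasIrreducibleModPGaloisRep_of_eleven_le) {p : ℕ} [Fact p.Prime]
    (hp : p = 11 ∨ p = 17 ∨ p = 19 ∨ p = 37 ∨ p = 43 ∨ p = 67 ∨ p = 163) (W : WeierstrassCurve ℚ) [W.IsElliptic] [W.IsGloballyMinimal]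
    (hX : ClassX3 W p) (hS : Additive.SubM W p) : False :=
  not_potMult_of_red_of_mem_seven hJ hp W hX.1 hS

/-! ### §3 The primes of the (M) row: `p ∈ {2, 3, 5, 7, 13}` -/

/-- **The primes of the reducible (M) row.**  If `ClassX3 W p` and `SubM W p` then `p ∈ {2, 3, 5, 7, 13}`: Mazur's Thm. 1 puts `p` among the
twelve isogeny primes and §2 removes the seven genus-positive ones (census: all 4 541 (M) pairs lie at `p ∈ {3, 5, 7, 13}`; `2` is excluded by
the crux's own `p ≠ 2`).  CONDITIONAL on the two displayed published facts. [cite: Mazur1978, Thm. 1 and table p. 129] -/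
theorem mem_rowPrimesM_of_classX3_of_subM (hM : mazur_isogeny_irreducible) (hJ : mazur_j_mem_of_not_hasIrreducibleModPGaloisRep_of_eleven_le)
    {p : ℕ} [Fact p.Prime] (W : WeierstrassCurve ℚ) [W.IsElliptic] [W.IsGloballyMinimal] (hX : ClassX3 W p) (hS : Additive.SubM W p) :
    p ∈ ({2, 3, 5, 7, 13} : Finset ℕ) := by
  have hp : p.Prime := Fact.out
  have hmem : p ∈ mazurPrimes := by
    by_contra h
    exact hX.1 (hM W p hp h)
  simp only [mazurPrimes, Finset.mem_insert, Finset.mem_singleton] at hmem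
  simp only [Finset.mem_insert, Finset.mem_singleton]
  rcases hmem with h | h | h | h | h | h | h | h | h | h | h | h
  any_goals omega
  all_goals exact (false_of_classX3_of_subM_of_mem hJ (by omega) W hX hS).elim

/-! ### §4 Crux r2 BY NAME from its four instances -/

/-- **Crux r2 `PotMultBranchIMC` is the conjunction of its OWN instances at `p ∈ {3, 5, 7, 13}`** (in its currency
`AdditiveIMCLowerBDPInputManinAt W p` on the (M) cell): at every other odd prime `ClassX3 W p ∧ SubM W p` is contradictory (§3), so the crux holds
VACUOUSLY there.  CONDITIONAL on Mazur's two displayed published facts; nothing is closed (19176 stays OPEN); BSD is NOT advanced.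
[cite: Mazur1978, Thm. 1 and table p. 129] -/
theorem potMultBranchIMC_of_rowPrimes (hM : mazur_isogeny_irreducible) (hJ : mazur_j_mem_of_not_hasIrreducibleModPGaloisRep_of_eleven_le)
    (h : ∀ (W : WeierstrassCurve ℚ) [W.IsElliptic] [W.IsGloballyMinimal] (p : ℕ) [Fact p.Prime],
      p = 3 ∨ p = 5 ∨ p = 7 ∨ p = 13 → W.analyticRank = 1 → ClassX3 W p → Additive.SubM W p → AdditiveIMCLowerBDPInputManinAt W p) :
    Summit.BirchSwinnertonDyer.BirchSwinnertonDyer.Theses.SchneiderFreeAdditiveX3.PotMultBranchIMC := by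
  intro W _ _ p _ hr hp2 hX hS
  have hmem := mem_rowPrimesM_of_classX3_of_subM hM hJ W hX hS
  simp only [Finset.mem_insert, Finset.mem_singleton] at hmem
  rcases hmem with h2 | h4
  · exact absurd h2 hp2
  · exact h W p h4 hr hX hS

end Summit.BirchSwinnertonDyer.BirchSwinnertonDyer.Theorems.SchneiderFreeAdditiveX3.KYBranchRowPrimesPotMult

end
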